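import Literature.NumberTheory.GaloisRepresentations.HomDualShaTwoConnecting
import Literature.NumberTheory.GaloisRepresentations.HomDualLocalData
import HarnessLib

/-!
# Property (e) of the native obstruction map — `Ш²(K, M^D) ⊆ Im Ψ` — REDUCED to Milne I Lemma 4.13 in two precise forms:
# (A) the local–global principle for `H²(K, Hom(P, K̄ˣ))` on `Ш²`-classes, (B) `Ш¹(K, Hom(N₁, K̄ˣ))` dies in `H¹(K, Hom(N₁, J̄))`

Topic `NumberTheory/GaloisRepresentations`; namespace `Literature.NumberTheory.GaloisRepresentations.HomDual`.
Theorems only; no definition, no named fact, no instance, no `sorry`.  Sequel of `HomDualShaTwoConnecting` (the NATIVE map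
`Ψ = shaTwoConnecting ρ n hM = H²(e⁻¹) ∘ δ₁^{Hom(S, K̄ˣ)} ∘ δ₀^{Hom(N₁, T)}` with (a)–(d)), `HomDualLocalData` /
`HomDualRestrictField` / `HomPermutationModuleVanishing` (door-c6: `H¹(K_v, Hom(P|_v, K̄_vˣ)) = 0`) and
`HomDualCovariantSequence` (`IsSES.map_res_δ₁`).

THE MATHEMATICS (Milne, *ADT* I Thm. 4.10 (a), proof p. 58: `Ш²(K, M^D) = Im(Ext¹(M, C̄) → Ext²(M, K̄ˣ))`, the half
`⊇`).  `K` a number field, `ρ` finite `n`-torsion on `M`, `S : 0 → N₁ → P → M → 0` door-c4's presentation,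
`T : 0 → K̄ˣ → J̄ → C̄ → 0` door-c5's idèle class sequence.  Let `c ∈ Ш²(K, M^D)`, `c' = H²(e) c ∈ H²(K, Hom(M, K̄ˣ))`.
* By exactness of `H¹(Hom(N₁, K̄ˣ)) —δ₁→ H²(Hom(M, K̄ˣ)) —p^*→ H²(Hom(P, K̄ˣ))` (`IsSES.exists_δ₁_eq_of_map_two_eq_zero`),
  `c' = δ₁ y` for some `y` AS SOON AS **(A) `H²(p^*) c' = 0`** — the local–global principle for
  `H²(K, Hom(P, K̄ˣ)) ≅ Br(K(M))^{|M|}` (Shapiro) applied to a class that is locally trivial because `c` is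
  (Brauer–Hasse–Noether for `K(M)`); NOT proved here.
* Such a `y` is LOCALLY TRIVIAL at every place `v` (`localTransfer_eq_zero_of_δ₁_eq`): its transfer
  `y_v = H¹(res_v, ι_v ∘ –) y ∈ H¹(K_v, Hom(N₁|_v, K̄_vˣ))` has `δ₁^{K_v} y_v = H²(res_v, ι_v ∘ –)(δ₁ y) = H²(e_v)(loc_v c) = 0`
  (`IsSES.map_res_δ₁` and the compatibility of door-c6's identifications `e`, `e_v` with restriction), hence lies in the
  image of `H¹(K_v, Hom(P|_v, K̄_vˣ)) = 0` (door-c6 `galoisCohomology_hom_units_eq_zero` at the restricted permutation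
  presentation).
* By exactness of `Hom_Γ(N₁, C̄) —δ₀→ H¹(Hom(N₁, K̄ˣ)) → H¹(Hom(N₁, J̄))` (`IsSES.exists_δ₀_eq_of_map_one_eq_zero`),
  `y = δ₀ h` for an equivariant `h : N₁ → C̄` AS SOON AS **(B)** the class `y`, locally trivial at every place, DIES in
  `H¹(K, Hom(N₁, J̄))` — Milne I Lemma 4.13 in degree `1` for the lattice `N₁`
  (`H¹(K, Hom(N₁, J̄)) ↪ ∏_v H¹(K_v, Hom(N₁, K̄_vˣ))`); NOT proved here.
* Then `Ψ h = H²(e⁻¹)(δ₁(δ₀ h)) = H²(e⁻¹) c' = c`.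
Main theorem: **`exists_shaTwoConnecting_eq_of_localGlobal`** — (e) for `shaTwoConnecting ρ n hM` from (A) and (B), both
displayed as Lean-typed hypotheses in the tree's native currency (no idèle projection is needed for this direction).
HONEST FRAMING: a reduction; no case of Poitou–Tate or BSD is proved here.

## References
* J. S. Milne, *Arithmetic Duality Theorems* (2nd ed. 2006), I Thm. 4.10 (a) (proof, p. 58), Lemma 4.13. [MilneADT2006]
* J. W. S. Cassels, A. Fröhlich (eds.), *Algebraic Number Theory* (1967), Ch. VII §9.6–§10 (Brauer–Hasse–Noether),
  §11.1. [CasselsFrohlichANT1967]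
* J. Neukirch, A. Schmidt, K. Wingberg, *Cohomology of Number Fields* (2008), (1.3.2), (1.5.2), (8.1.17).
  [NeukirchSchmidtWingberg2008]
-/

noncomputable section

open CategoryTheory CategoryTheory.Limits NumberField
open Field (absoluteGaloisGroup)
open scoped ContRepresentation

namespace Literature.NumberTheory.GaloisRepresentations

namespace HomDual

open Literature.Algebra.Homology Literature.Algebra.Homology.DiscreteRep DiscreteGaloisModule IdeleClassBar
  FreePresentation DGMBridge HomPermutation

variable {K : Type} [Field K] [NumberField K]
variable {M : Type} [AddCommGroup M] [TopologicalSpace M] [DiscreteTopology M] [Finite M]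
variable (ρ : DiscreteGaloisModule K M) (n : ℕ) [NeZero n] (hM : ∀ m : M, n • m = 0)

/-! ## §1 The transfer `y_v = H¹(res_v, ι_v ∘ –) y` of a class `y ∈ H¹(K, Hom(N₁, K̄ˣ))` with `δ₁ y = H²(e) c`, `c ∈ Ш²`, vanishes -/

/-- **`H²(res_v, ι_v ∘ –)(H²(e) c) = H²(e_v)(loc_v c)`**: door-c6's identifications `e = tateDualUnitsIso` (global) and
`e_v = tateDualRestrictUnitsIso` (over `K_v`) intertwine localisation on `H²(·, M^D)` with restriction-and-transfer on
`H²(·, Hom_ℤ(M, K̄ˣ))` (degree-`2` companion of door-c6's (R2) bookkeeping). [cite: MilneADT2006, I §0, I §2, I §4]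
[cite: NeukirchSchmidtWingberg2008, (1.5.2)] -/
theorem map_postcompResHom_cohomologyMap_tateDualUnitsIso_hom (v : Place K) [CharZero (Place.Completion v)]
    (c : galoisCohomology (ρ.tateDual n) 2) :
    ContinuousCohomology.map (absGaloisRestrict K (Place.Completion v))
        (postcompResHom ρ (units K) (units (Place.Completion v)) (unitsTransfer K (Place.Completion v))) 2
        (cohomologyMap (tateDualUnitsIso K ρ n hM).hom 2 c) =
      cohomologyMap (tateDualRestrictUnitsIso K (Place.Completion v) ρ n hM).hom 2
        (galoisCohomology.localization (ρ.tateDual n) v 2 c) := by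
  set L := Place.Completion v
  let θ : absoluteGaloisGroup L →ₜ* absoluteGaloisGroup K := absGaloisRestrict K L
  have hc : c = cohomologyMap (tateDualUnitsIso K ρ n hM).inv 2 (cohomologyMap (tateDualUnitsIso K ρ n hM).hom 2 c) :=
    (cohomologyMap_inv_hom_apply (tateDualUnitsIso K ρ n hM) 2 c).symm
  conv_rhs => rw [hc]
  have h1 : galoisCohomology.localization (ρ.tateDual n) v 2 (cohomologyMap (tateDualUnitsIso K ρ n hM).inv 2
      (cohomologyMap (tateDualUnitsIso K ρ n hM).hom 2 c)) =
      ContinuousCohomology.map θ (resAlongHom θ (tateDualUnitsIso K ρ n hM).inv) 2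
        (cohomologyMap (tateDualUnitsIso K ρ n hM).hom 2 c) :=
    (map_resAlongHom_eq θ (tateDualUnitsIso K ρ n hM).inv 2 _).symm
  rw [h1]
  exact map_comp_apply_of θ (ContinuousMonoidHom.id _) θ (fun _ => rfl)
    (resAlongHom θ (tateDualUnitsIso K ρ n hM).inv) (resIdHom (tateDualRestrictUnitsIso K L ρ n hM).hom)
    (postcompResHom ρ (units K) (units L) (unitsTransfer K L))
    (fun F => postcompAddHom_unitsTransfer_eq_restrict L ρ n hM F) 2 _

/-- **The transfer of `y` to every place vanishes** if `δ₁ y = H²(e) c` with `c ∈ Ш²(K, M^D)`: over `K_v`,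
`δ₁^{K_v}(y_v) = H²(res_v, ι_v ∘ –)(δ₁ y) = H²(e_v)(loc_v c) = 0` (`IsSES.map_res_δ₁`), so `y_v` comes from
`H¹(K_v, Hom(P|_v, K̄_vˣ)) = 0` (door-c6: Hilbert 90 + Shapiro at the restricted permutation presentation).
[cite: MilneADT2006, I Thm. 4.10 (proof, p. 58), Lemma 4.13 (proof)][cite: NeukirchSchmidtWingberg2008, (1.3.2), (1.5.2)] -/
theorem localTransfer_eq_zero_of_δ₁_eq (v : Place K)
    (c : galoisCohomology (ρ.tateDual n) 2) (hc : galoisCohomology.localization (ρ.tateDual n) v 2 c = 0)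
    (y : haveI := moduleFinite_presModule₁ ρ
      galoisCohomology (homGaloisModule (presModule₁ ρ) (units K)) 1)
    (hy : haveI := moduleFinite_presModule₁ ρ
      haveI := moduleFinite_presModule₂ ρ
      haveI := absoluteGaloisGroup_compactSpace K
      (dual_pres_isSES ρ).δ₁ y = cohomologyMap (tateDualUnitsIso K ρ n hM).hom 2 c) :
    haveI := moduleFinite_presModule₁ ρ
    ContinuousCohomology.map (absGaloisRestrict K (Place.Completion v))
      (postcompResHom (presModule₁ ρ) (units K) (units (Place.Completion v)) (unitsTransfer K (Place.Completion v))) 1 y = 0 := by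
  haveI := moduleFinite_presModule₁ ρ
  haveI := moduleFinite_presModule₂ ρ
  haveI := absoluteGaloisGroup_compactSpace K
  haveI := absoluteGaloisGroup_compactSpace (Place.Completion v)
  haveI : CharZero (Place.Completion v) := charZero_of_algebra (K := K) (Place.Completion v)
  haveI := (presentationLayer ρ).finiteDimensional
  haveI := (presentationLayer ρ).isGalois
  haveI := normal_localLayer K (Place.Completion v) (presentationLayer ρ).1
  haveI := finiteDimensional_localLayer K (Place.Completion v) (presentationLayer ρ).1
  set L := Place.Completion v
  let θ : absoluteGaloisGroup L →ₜ* absoluteGaloisGroup K := absGaloisRestrict K L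
  -- the dual sequence of the restricted presentation over `K_v`
  have hSv := isSES_dual ((presModule₁ ρ).restrictField L) ((presModule₂ ρ).restrictField L) (ρ.restrictField L) (units L)
    (restrictIntertwining (presModule₁ ρ) (presModule₂ ρ) (presIncl ρ)) (restrictIntertwining (presModule₂ ρ) ρ (presProj ρ))
    (isSES_restrict (presModule₁ ρ) (presModule₂ ρ) ρ (pres_isSES ρ)) (baer_unitsCarrier L)
  -- `δ₁^{K_v}(y_v) = H²(res_v, ι_v ∘ –)(δ₁ y) = H²(e_v)(loc_v c) = 0`
  have hδ : hSv.δ₁ (ContinuousCohomology.map θ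
      (postcompResHom (presModule₁ ρ) (units K) (units L) (unitsTransfer K L)) 1 y) = 0 := by
    rw [← IsSES.map_res_δ₁ θ (postcompResHom ρ (units K) (units L) (unitsTransfer K L))
      (postcompResHom (presModule₂ ρ) (units K) (units L) (unitsTransfer K L))
      (postcompResHom (presModule₁ ρ) (units K) (units L) (unitsTransfer K L)) (dual_pres_isSES ρ) hSv
      (fun _ => rfl) (fun _ => rfl) y, hy, map_postcompResHom_cohomologyMap_tateDualUnitsIso_hom ρ n hM v c, hc]
    exact map_zero _
  -- so `y_v` comes from `H¹(K_v, Hom(P|_v, K̄_vˣ)) = 0`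
  obtain ⟨y', hy'⟩ := hSv.exists_map_one_eq_of_δ₁_eq_zero _ hδ
  letI := resAction K L (PresIndex ρ)
  have hy'0 : y' = 0 :=
    galoisCohomology_hom_units_eq_zero (uniformIsotropy_restrict (uniformIsotropy_presIndex ρ))
      (permutedBasis_restrict (permutedBasis_presModule₂ ρ)) y'
  rw [← hy', hy'0, map_zero]

/-! ## §2 Property (e) from (A) and (B) -/

/-- **Property (e) `Ш²(K, M^D) ⊆ Im Ψ` of the native obstruction map, from Milne I Lemma 4.13 in the two forms (A), (B).**
(A): for every `c ∈ Ш²(K, M^D)`, the class `H²(p^*)(H²(e) c) ∈ H²(K, Hom_ℤ(P, K̄ˣ))` vanishes (local–global principle for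
`H²(K, Hom(P, K̄ˣ)) ≅ Br(K(M))^{|M|}`, Brauer–Hasse–Noether).  (B): a class `y ∈ H¹(K, Hom_ℤ(N₁, K̄ˣ))` whose transfer
`H¹(res_v, ι_v ∘ –) y ∈ H¹(K_v, Hom_ℤ(N₁|_v, K̄_vˣ))` vanishes at EVERY place `v` dies in `H¹(K, Hom_ℤ(N₁, J̄))`
(`H¹(K, Hom(N₁, J̄)) ↪ ∏_v H¹(K_v, Hom(N₁, K̄_vˣ))`).  CONCLUSION: every `c ∈ Ш²(K, M^D)` is `shaTwoConnecting ρ n hM h` for some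
`h : N₁ ⟶ C̄` — the hypothesis `hΨsurj` of `PoitouTateShaTwoReadout.shaTwo_tateDual_of_shaTwoConnecting`.
HONEST FRAMING: a reduction; (A) and (B) are displayed hypotheses, not proved here.
[cite: MilneADT2006, I Thm. 4.10 (a) (proof, p. 58), Lemma 4.13][cite: CasselsFrohlichANT1967, Ch. VII §9.6, §10, §11.1] -/
theorem exists_shaTwoConnecting_eq_of_localGlobal
    (hA : haveI := moduleFinite_presModule₂ ρ
      ∀ c ∈ shaTwo (ρ.tateDual n),
        cohomologyMap (dualF (presModule₂ ρ) ρ (units K) (presProj ρ)) 2 (cohomologyMap (tateDualUnitsIso K ρ n hM).hom 2 c) = 0)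
    (hB : haveI := moduleFinite_presModule₁ ρ
      ∀ y : galoisCohomology (homGaloisModule (presModule₁ ρ) (units K)) 1,
        (∀ v : Place K, ContinuousCohomology.map (absGaloisRestrict K (Place.Completion v))
          (postcompResHom (presModule₁ ρ) (units K) (units (Place.Completion v)) (unitsTransfer K (Place.Completion v))) 1 y = 0) →
        cohomologyMap (homF (presModule₁ ρ) (units K) (toDGM (ideleBarD K)) (unitsToIdeleI K)) 1 y = 0)
    (c : galoisCohomology (ρ.tateDual n) 2) (hc : c ∈ shaTwo (ρ.tateDual n)) :
    ∃ h : (presentationComplex ρ).X₁ ⟶ classBarD K, shaTwoConnecting ρ n hM h = c := by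
  haveI := moduleFinite_presModule₁ ρ
  haveI := moduleFinite_presModule₂ ρ
  haveI := absoluteGaloisGroup_compactSpace K
  -- (A): `H²(e) c = δ₁ y`
  obtain ⟨y, hy⟩ := (dual_pres_isSES ρ).exists_δ₁_eq_of_map_two_eq_zero _ (hA c hc)
  -- `y` is locally trivial at every place, hence (B): `y = δ₀ w`
  have hyloc := fun v : Place K =>
    localTransfer_eq_zero_of_δ₁_eq ρ n hM v c ((mem_shaTwo_iff _ c).1 hc v) y hy
  obtain ⟨w, hw⟩ := (hom_idele_isSES ρ).exists_δ₀_eq_of_map_one_eq_zero y (hB y hyloc)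
  -- the invariant `w` of `Hom(N₁, C̄)` is a `C_Γ`-morphism `h : N₁ ⟶ C̄`
  let h : (presentationComplex ρ).X₁ ⟶ classBarD K :=
    homOfEquivariant (presentationComplex ρ).X₁ (classBarD K)
      (show LCarrier (presentationComplex ρ).X₁ →ₗ[ℤ] LCarrier (classBarD K) from
        (w.1 : DiscreteRep.HomCarrier (LCarrier (presentationComplex ρ).X₁) (LCarrier (classBarD K)))).toAddMonoidHom
      (fun σ x => (mem_invariants_iff _ _ w.1).1 w.2 σ x)
  have hh : homInvariant (presentationComplex ρ).X₁ (classBarD K) h = w := Subtype.ext (LinearMap.ext fun _ => rfl)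
  refine ⟨h, ?_⟩
  rw [shaTwoConnecting_apply, hh, hw, hy]
  exact cohomologyMap_inv_hom_apply (tateDualUnitsIso K ρ n hM) 2 c

end HomDual

end Literature.NumberTheory.GaloisRepresentations

end
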